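import Literature.AlgebraicGeometry.Frobenioids.EquivalenceFrobeniusTypeFromPreSteps
import Literature.AlgebraicGeometry.Frobenioids.EquivalenceLinearMorphisms
import HarnessLib

/-!
# Frobenioids I, §3: Theorem 3.4 (iii) — linear morphisms, base-isomorphisms, pull-back morphisms,
# isometries, LB-invertible morphisms, from the CONCLUSION of Theorem 3.4 (ii) (isotropic type)

Mochizuki, *The geometry of Frobenioids I: the general theory*, Kyushu J. Math. **62** (2008),
Thm. 3.4 (iii), proof, kurims p. 64: "… hence that `Ψ` preserves linear morphisms and morphisms of
Frobenius type [by Proposition 1.7, (iii)]. Moreover, by assertions (i), (ii), `Ψ` preserves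
isometric pre-steps and pre-steps, hence also base-isomorphisms … Thus, by Proposition 1.7, (ii),
`Ψ` preserves pull-back morphisms. … `Ψ` preserves isometries" [cite: MochizukiFrdI2008, Thm. 3.4 (iii) p.64].

PROOF-ONLY (seat abc-iut-L1-t13, gen 2). Third file of the `…FromPreSteps` re-run (programme in
`EquivalenceFrobeniusEndomorphismsFromPreSteps.lean`): the proofs of `EquivalenceLinearMorphisms.lean`
(p410374) with "`D₁`, `D₂` of FSM-type" replaced by the abstract conclusions of Thm. 3.4 (ii) for
`Ψ` and `Ψ⁻¹` — `hps`, `hps'` (pre-steps), `hgl`, `hgl'` (group-like objects). For Frobenioids of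
isotropic type with non-dilating divisor monoids and non-group-like objects as indicated, `Ψ` preserves
linear morphisms (Prop. 1.7 (iii): minimal-coadjoint to Frobenius type, preserved by `Ψ⁻¹`),
base-isomorphisms (Prop. 1.7 (ii): Frobenius type followed by a pre-step), pull-back morphisms (Prop.
1.7 (ii): minimal-adjoint to base-isomorphisms), isometries (Def. 1.3 (iv)(a) factorisation),
LB-invertible morphisms. No statement of the paper is restated or strengthened.
-/

set_option backward.isDefEq.respectTransparency false

namespace Literature.AlgebraicGeometry.Frobenioids

open CategoryTheory Opposite

universe w v v' u u'

namespace FrdI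

section Two

variable {D₁ : Type u} [Category.{v} D₁] {Φ₁ : D₁ᵒᵖ ⥤ CommMonCat.{w}} {C₁ : Type u'}
  [Category.{v'} C₁] {D₂ : Type u} [Category.{v} D₂] {Φ₂ : D₂ᵒᵖ ⥤ CommMonCat.{w}} {C₂ : Type u'}
  [Category.{v'} C₂] {F₁ : C₁ ⥤ ElemFrobenioid Φ₁} {F₂ : C₂ ⥤ ElemFrobenioid Φ₂}

/-- **Thm. 3.4 (iii): `Ψ` preserves linear morphisms** (Prop. 1.7 (iii) + Frobenius type preserved by
`Ψ⁻¹`; `Ψ`, `Ψ⁻¹` preserve pre-steps, `Ψ` preserves group-like objects, `C₂` has a non-group-like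
object, `Φ₁` non-dilating). [cite: MochizukiFrdI2008, Thm. 3.4 (iii) p.64] -/
theorem isLinear_map_ps (hF₁ : PreFrobenioid.IsFrobenioid F₁) (hF₂ : PreFrobenioid.IsFrobenioid F₂)
    (hi₁ : ∀ A : C₁, PreFrobenioid.IsIsotropic F₁ A) (hi₂ : ∀ A : C₂, PreFrobenioid.IsIsotropic F₂ A)
    (hnd₁ : IsNonDilatingOn Φ₁) (Ψ : C₁ ≌ C₂)
    (hps : ∀ ⦃X Y : C₁⦄ ⦃f : X ⟶ Y⦄, PreFrobenioid.IsPreStep F₁ f →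
      PreFrobenioid.IsPreStep F₂ (Ψ.functor.map f))
    (hps' : ∀ ⦃X Y : C₂⦄ ⦃g : X ⟶ Y⦄, PreFrobenioid.IsPreStep F₂ g →
      PreFrobenioid.IsPreStep F₁ (Ψ.inverse.map g))
    (hgl : ∀ ⦃X : C₁⦄, PreFrobenioid.IsGroupLikeObj F₁ X →
      PreFrobenioid.IsGroupLikeObj F₂ (Ψ.functor.obj X))
    {N₂ : C₂} (hN₂ : ¬ PreFrobenioid.IsGroupLikeObj F₂ N₂) {A B : C₁} {φ : A ⟶ B}
    (hφ : PreFrobenioid.IsLinear F₁ φ) : PreFrobenioid.IsLinear F₂ (Ψ.functor.map φ) := by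
  rw [PreFrobenioid.isLinear_iff_isMinimalAdjoint F₂ hF₂]
  refine ((PreFrobenioid.isLinear_iff_isMinimalAdjoint F₁ hF₁ φ).1 hφ).map_equivalence Ψ
    (S₂ := fun _ _ f => PreFrobenioid.IsFrobeniusType F₂ f) (fun X Y β hβ => ?_) (fun X X' Y i β hi hβ => ?_)
  · exact isFrobeniusType_map_ps hF₂ hF₁ hi₂ hi₁ hnd₁ Ψ.symm hps' hps hgl hN₂ _ hβ rfl
  · haveI := hi
    exact PreFrobenioid.IsFrobeniusType.comp F₁ hF₁ (PreFrobenioid.isFrobeniusType_of_isIso F₁ hF₁.isPreFrobenioid i) hβ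

/-- **Thm. 3.4 (iii): `Ψ` preserves base-isomorphisms** (Prop. 1.7 (ii): a base-isomorphism is a
morphism of Frobenius type followed by a pre-step; `Ψ`, `Ψ⁻¹` preserve pre-steps, `Ψ⁻¹` preserves
group-like objects, `C₁` has a non-group-like object, `Φ₂` non-dilating).
[cite: MochizukiFrdI2008, Thm. 3.4 (iii) p.64] -/
theorem isBaseIso_map_ps (hF₁ : PreFrobenioid.IsFrobenioid F₁) (hF₂ : PreFrobenioid.IsFrobenioid F₂)
    (hi₁ : ∀ A : C₁, PreFrobenioid.IsIsotropic F₁ A) (hi₂ : ∀ A : C₂, PreFrobenioid.IsIsotropic F₂ A)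
    (hnd₂ : IsNonDilatingOn Φ₂) (Ψ : C₁ ≌ C₂)
    (hps : ∀ ⦃X Y : C₁⦄ ⦃f : X ⟶ Y⦄, PreFrobenioid.IsPreStep F₁ f →
      PreFrobenioid.IsPreStep F₂ (Ψ.functor.map f))
    (hps' : ∀ ⦃X Y : C₂⦄ ⦃g : X ⟶ Y⦄, PreFrobenioid.IsPreStep F₂ g →
      PreFrobenioid.IsPreStep F₁ (Ψ.inverse.map g))
    (hgl' : ∀ ⦃Y : C₂⦄, PreFrobenioid.IsGroupLikeObj F₂ Y →
      PreFrobenioid.IsGroupLikeObj F₁ (Ψ.inverse.obj Y))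
    {N₁ : C₁} (hN₁ : ¬ PreFrobenioid.IsGroupLikeObj F₁ N₁) {A B : C₁} {φ : A ⟶ B}
    (hφ : PreFrobenioid.IsBaseIso F₁ φ) : PreFrobenioid.IsBaseIso F₂ (Ψ.functor.map φ) := by
  obtain ⟨X, β, α, hfac, hβ, hα⟩ :=
    (PreFrobenioid.isBaseIso_iff_exists_frobeniusType_preStep F₁ hF₁ φ).1 hφ
  rw [← hfac, Functor.map_comp]
  exact PreFrobenioid.IsBaseIso.comp F₂
    (isFrobeniusType_map_ps hF₁ hF₂ hi₁ hi₂ hnd₂ Ψ hps hps' hgl' hN₁ _ hβ rfl).2 (hps hα).2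

/-- **Thm. 3.4 (iii): `Ψ` preserves pull-back morphisms** (Prop. 1.7 (ii): minimal-adjoint to the
base-isomorphisms, which `Ψ⁻¹` preserves). [cite: MochizukiFrdI2008, Thm. 3.4 (iii) p.64] -/
theorem isPullbackMorphism_map_ps (hF₁ : PreFrobenioid.IsFrobenioid F₁)
    (hF₂ : PreFrobenioid.IsFrobenioid F₂) (hi₁ : ∀ A : C₁, PreFrobenioid.IsIsotropic F₁ A)
    (hi₂ : ∀ A : C₂, PreFrobenioid.IsIsotropic F₂ A) (hnd₁ : IsNonDilatingOn Φ₁) (Ψ : C₁ ≌ C₂)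
    (hps : ∀ ⦃X Y : C₁⦄ ⦃f : X ⟶ Y⦄, PreFrobenioid.IsPreStep F₁ f →
      PreFrobenioid.IsPreStep F₂ (Ψ.functor.map f))
    (hps' : ∀ ⦃X Y : C₂⦄ ⦃g : X ⟶ Y⦄, PreFrobenioid.IsPreStep F₂ g →
      PreFrobenioid.IsPreStep F₁ (Ψ.inverse.map g))
    (hgl : ∀ ⦃X : C₁⦄, PreFrobenioid.IsGroupLikeObj F₁ X →
      PreFrobenioid.IsGroupLikeObj F₂ (Ψ.functor.obj X))
    {N₂ : C₂} (hN₂ : ¬ PreFrobenioid.IsGroupLikeObj F₂ N₂)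
    {A B : C₁} {φ : A ⟶ B} (hφ : PreFrobenioid.IsPullbackMorphism F₁ φ) :
    PreFrobenioid.IsPullbackMorphism F₂ (Ψ.functor.map φ) := by
  rw [PreFrobenioid.isPullbackMorphism_iff_isMinimalAdjoint F₂ hF₂]
  refine ((PreFrobenioid.isPullbackMorphism_iff_isMinimalAdjoint F₁ hF₁ φ).1 hφ).map_equivalence Ψ
    (S₂ := PreFrobenioid.baseIsomorphisms F₂) (fun X Y β hβ => ?_) (fun X X' Y i β hi hβ => ?_)
  · exact isBaseIso_map_ps hF₂ hF₁ hi₂ hi₁ hnd₁ Ψ.symm hps' hps hgl hN₂ hβ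
  · haveI := hi
    exact PreFrobenioid.IsBaseIso.comp F₁ (PreFrobenioid.isBaseIso_of_isIso F₁ i) hβ

/-- **Thm. 3.4 (iii): `Ψ` preserves isometries** (factor `φ = α ∘ β ∘ γ`, Def. 1.3 (iv)(a): the
pre-step `β` is isometric, hence invertible in isotropic type; `Ψγ` is of Frobenius type and `Ψα` a
pull-back morphism). [cite: MochizukiFrdI2008, Thm. 3.4 (iii) p.64] -/
theorem isIsometry_map_ps (hF₁ : PreFrobenioid.IsFrobenioid F₁) (hF₂ : PreFrobenioid.IsFrobenioid F₂)
    (hi₁ : ∀ A : C₁, PreFrobenioid.IsIsotropic F₁ A) (hi₂ : ∀ A : C₂, PreFrobenioid.IsIsotropic F₂ A)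
    (hnd₁ : IsNonDilatingOn Φ₁) (hnd₂ : IsNonDilatingOn Φ₂) (Ψ : C₁ ≌ C₂)
    (hps : ∀ ⦃X Y : C₁⦄ ⦃f : X ⟶ Y⦄, PreFrobenioid.IsPreStep F₁ f →
      PreFrobenioid.IsPreStep F₂ (Ψ.functor.map f))
    (hps' : ∀ ⦃X Y : C₂⦄ ⦃g : X ⟶ Y⦄, PreFrobenioid.IsPreStep F₂ g →
      PreFrobenioid.IsPreStep F₁ (Ψ.inverse.map g))
    (hgl : ∀ ⦃X : C₁⦄, PreFrobenioid.IsGroupLikeObj F₁ X →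
      PreFrobenioid.IsGroupLikeObj F₂ (Ψ.functor.obj X))
    (hgl' : ∀ ⦃Y : C₂⦄, PreFrobenioid.IsGroupLikeObj F₂ Y →
      PreFrobenioid.IsGroupLikeObj F₁ (Ψ.inverse.obj Y))
    {N₁ : C₁} (hN₁ : ¬ PreFrobenioid.IsGroupLikeObj F₁ N₁)
    {N₂ : C₂} (hN₂ : ¬ PreFrobenioid.IsGroupLikeObj F₂ N₂) {A B : C₁} {φ : A ⟶ B}
    (hφ : PreFrobenioid.IsIsometry F₁ φ) : PreFrobenioid.IsIsometry F₂ (Ψ.functor.map φ) := by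
  have hP₁ := hF₁.isPreFrobenioid
  have hP₂ := hF₂.isPreFrobenioid
  obtain ⟨X, Y, γ, β, α, hfac, hγ, hβ, hα⟩ := hF₁.iv_a_exists φ
  -- the middle pre-step is an isometry, hence an isomorphism
  have hβi : PreFrobenioid.IsIsometry F₁ β := by
    have h : PreFrobenioid.IsIsometry F₁ (γ ≫ β ≫ α) := by rw [hfac]; exact hφ
    exact (PreFrobenioid.isIsometry_factors F₁ hP₁ (PreFrobenioid.isIsometry_factors F₁ hP₁ h).1).2
  haveI : IsIso β := hi₁ X β hβi hβ
  rw [← hfac, Functor.map_comp, Functor.map_comp]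
  refine PreFrobenioid.IsIsometry.comp F₂
    (isFrobeniusType_map_ps hF₁ hF₂ hi₁ hi₂ hnd₂ Ψ hps hps' hgl' hN₁ _ hγ rfl).1.2
    (PreFrobenioid.IsIsometry.comp F₂ (PreFrobenioid.isIsometry_of_isIso F₂ hP₂ _) ?_)
  exact (hF₂.iv_b _ (isPullbackMorphism_map_ps hF₁ hF₂ hi₁ hi₂ hnd₁ Ψ hps hps' hgl hN₂ hα)).1.2

/-- **Thm. 3.4 (iii): `Ψ` preserves co-angular and LB-invertible morphisms** (every morphism of a
Frobenioid of isotropic type is co-angular). [cite: MochizukiFrdI2008, Thm. 3.4 (iii) p.64] -/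
theorem isLBInvertible_map_ps (hF₁ : PreFrobenioid.IsFrobenioid F₁)
    (hF₂ : PreFrobenioid.IsFrobenioid F₂) (hi₁ : ∀ A : C₁, PreFrobenioid.IsIsotropic F₁ A)
    (hi₂ : ∀ A : C₂, PreFrobenioid.IsIsotropic F₂ A) (hnd₁ : IsNonDilatingOn Φ₁)
    (hnd₂ : IsNonDilatingOn Φ₂) (Ψ : C₁ ≌ C₂)
    (hps : ∀ ⦃X Y : C₁⦄ ⦃f : X ⟶ Y⦄, PreFrobenioid.IsPreStep F₁ f →
      PreFrobenioid.IsPreStep F₂ (Ψ.functor.map f))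
    (hps' : ∀ ⦃X Y : C₂⦄ ⦃g : X ⟶ Y⦄, PreFrobenioid.IsPreStep F₂ g →
      PreFrobenioid.IsPreStep F₁ (Ψ.inverse.map g))
    (hgl : ∀ ⦃X : C₁⦄, PreFrobenioid.IsGroupLikeObj F₁ X →
      PreFrobenioid.IsGroupLikeObj F₂ (Ψ.functor.obj X))
    (hgl' : ∀ ⦃Y : C₂⦄, PreFrobenioid.IsGroupLikeObj F₂ Y →
      PreFrobenioid.IsGroupLikeObj F₁ (Ψ.inverse.obj Y))
    {N₁ : C₁} (hN₁ : ¬ PreFrobenioid.IsGroupLikeObj F₁ N₁) {N₂ : C₂}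
    (hN₂ : ¬ PreFrobenioid.IsGroupLikeObj F₂ N₂)
    {A B : C₁} {φ : A ⟶ B} (hφ : PreFrobenioid.IsLBInvertible F₁ φ) :
    PreFrobenioid.IsLBInvertible F₂ (Ψ.functor.map φ) :=
  ⟨PreFrobenioid.isCoAngular_of_isIsotropic_codomains F₂ _ (fun Z _ => hi₂ Z),
    isIsometry_map_ps hF₁ hF₂ hi₁ hi₂ hnd₁ hnd₂ Ψ hps hps' hgl hgl' hN₁ hN₂ hφ.2⟩

end Two

end FrdI

end Literature.AlgebraicGeometry.Frobenioids
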